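import Summits.HubbardSuperconductivity.HubbardSuperconductivity.Theorems.ThermalWedgeTwSeededRungStructural

/-!
# Route `ThermalWedge` — the MASTER finite-volume rung inequality for the ANCHOR `TwSeededRung`
(stmt-HubbardSuperconductivity-1699)

Companion of the route-file-free engine `ThermalWedgeTwSeededRungStructural.lean`
(`twSeededRung_structural : ⟦narrowed TwSeededEnsembleEquivalence⟧ → ⟦TwSourcedCondensation⟧ →
⟦TwSeededRung⟧`). This module (also route-file-free, so that a closing theorem built on it can be
linked as `TwSeededRung_holds`) isolates the ONE inequality through which the two cruxes enter the
anchor, at FINITE volume and with every thermodynamic parameter free: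

* `tw_rung_master`: for every side `L`, every `U, μ`, every `β > 0`, every seed `g > 0`, every
  probe source `s` and every normalised `(2n, S^z = 0)`-sector ground state `ψ` of the seeded torus
  `H_L(U,g) = hubbardTorus 2 L 1 U − (g/L²)·P_L`, `P_L = (pairField d L)ᴴ(pairField d L)`,

      B_L(β,μ,U,s) − s²/g − A_L(β,μ,U,g;n) ≤ (g/L⁴)·Re⟨ψ, P_L ψ⟩,

  where `B_L := p̃_L(β,μ,U,s) − p̃_L(β,μ,U,0)` is the sourced-pressure GAIN of `dWaveSourceTorus`
  (the quantity crux `TwSourcedCondensation` bounds below) and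
  `A_L := E_L(U,g;2n,0)/L² + p_L(β,μ,U,g) − μ·2n/L²` (`≥ 0` by the trivial half of the one-point
  Legendre inequality) is the canonical/grand-canonical DEFECT of the seeded model (the quantity
  crux `TwSeededEnsembleEquivalence` bounds above). Proof = rung chord from the pure model `g' = 0`
  (`leftChord_le_order`) + Gibbs lower bound on the pure sector energy (`twr_sectorEnergy_zero_ge`)
  + approximating-Hamiltonian easy half (`twr_sourcedPressure_le_seededPressure_add`) +
  `dWaveSourceTorus_zero`; no limit, no threshold, no window.
* `twSeededRung_of_probe`: hence `TwSeededRung` (verbatim body) follows from ANY probe schedule —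
  for `δ ∈ [1/10,2/5]`, thresholds `U₀, K`, and for `U ∈ (0,U₀]`, `g ∈ [K·U, 1/10]` a margin
  `m(U,g) > 0` such that eventually in even `L` some `(β_L, μ_L, s_L)` (ALL THREE MAY DEPEND ON `L`)
  have `m ≤ B_L − s_L²/g − A_L`; the order constant is `c(U,g) = m/g`.

Use: whatever restated forms the cruxes stmt-…-1697 / stmt-…-1698 eventually take (narrowed
`β ≤ e^{a/U}`, pointwise probe `(β,s) = (e^{a/U}, e^{-a/(4U)})`, `μ` uniform or `L`-dependent),
the anchor closes from them by real arithmetic against `twSeededRung_of_probe`; in particular an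
`L`-DEPENDENT canonical chemical potential `μ_L` suffices for the defect as soon as the gain is
uniform in `μ` over the window — a strictly weaker ensemble input than `TwSeededEnsembleEquivalence`
(whose `μ` is chosen before `L`).
-/

namespace Summit.HubbardSuperconductivity.HubbardSuperconductivity.Theorems

open Literature.MathematicalPhysics.QuantumLattice Matrix
open Summit.HubbardSuperconductivity.TwTipContinuation.Negative

section Master

/-- **Master finite-volume rung inequality.** For every side `L`, interaction `U`, chemical
potential `μ`, inverse temperature `β > 0`, seed `g > 0`, probe source `s`, and every normalised
`(2n, S^z=0)`-sector ground state `ψ` of the seeded torus `H_L(U,g)`: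
`[p̃_L(β,μ,U,s) − p̃_L(β,μ,U,0)] − s²/g − [E_L(U,g)/L² + p_L(β,μ,U,g) − μ·2n/L²] ≤ (g/L⁴)·Re⟨ψ,P_Lψ⟩`
— sourced gain minus approximating-Hamiltonian penalty minus ensemble defect bounds the `d`-wave
pair intensity of EVERY sector ground state from below. (Chord from `g' = 0`, Gibbs bound on the
pure sector energy, AHM easy half.) [folklore] -/
theorem tw_rung_master (L : ℕ) [NeZero L] (U μ : ℝ) {β g : ℝ} (hβ : 0 < β) (hg : 0 < g) (s : ℝ)
    {n : ℕ} {ψ : Fock (Orb (FermionTorus 2 L))} (hψ : star ψ ⬝ᵥ ψ = 1)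
    (hgs : IsGroundStateInSector (hubbardTorus 2 L 1 U - ((g / (L : ℝ) ^ 2 : ℝ) : ℂ) •
      ((pairField dWaveFormFactor L)ᴴ * pairField dWaveFormFactor L)) (2 * n) 0 ψ) :
    (Real.log (partitionFn β (dWaveSourceTorus L U μ s)).re / (β * (L : ℝ) ^ 2) -
        Real.log (partitionFn β (dWaveSourceTorus L U μ 0)).re / (β * (L : ℝ) ^ 2)) -
      s ^ 2 / g -
      ((hubbardTorus 2 L 1 U - ((g / (L : ℝ) ^ 2 : ℝ) : ℂ) •
            ((pairField dWaveFormFactor L)ᴴ * pairField dWaveFormFactor L)).minEnergyOn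
          (szSector (Λ := FermionTorus 2 L) (2 * n) 0) / (L : ℝ) ^ 2 +
        Real.log (partitionFn β (hubbardTorusWith 2 L 1 U μ - ((g / (L : ℝ) ^ 2 : ℝ) : ℂ) •
          ((pairField dWaveFormFactor L)ᴴ * pairField dWaveFormFactor L))).re /
            (β * (L : ℝ) ^ 2) -
        μ * ((2 * n : ℕ) : ℝ) / (L : ℝ) ^ 2) ≤
      g / (L : ℝ) ^ 4 *
        (expect ((pairField dWaveFormFactor L)ᴴ * pairField dWaveFormFactor L) ψ).re := by
  have hLpos : (0 : ℝ) < (L : ℝ) := by exact_mod_cast NeZero.pos L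
  have hL2 : (0 : ℝ) < (L : ℝ) ^ 2 := by positivity
  have hL4 : (0 : ℝ) < (L : ℝ) ^ 4 := by positivity
  -- the rung chord from the pure model
  have hchord := leftChord_le_order (U := U) (g := g) (g' := 0) hg hψ hgs
  -- the Gibbs lower bound on the pure sector energy
  have hn : n ≤ Fintype.card (FermionTorus 2 L) := le_card_of_mem_szSector L hgs.1 hgs.2.1
  have hlow := twr_sectorEnergy_zero_ge L U μ hβ hn
  -- approximating Hamiltonian, easy half, at the probe source
  have hahm := twr_sourcedPressure_le_seededPressure_add L U μ hβ hg s
  rw [dWaveSourceTorus_zero]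
  -- bookkeeping: divide the chord by `L²`
  have h2 := div_le_div_of_nonneg_right hchord hL2.le
  have h3 : (g - 0) / (L : ℝ) ^ 2 *
      (expect ((pairField dWaveFormFactor L)ᴴ * pairField dWaveFormFactor L) ψ).re / (L : ℝ) ^ 2 =
      g / (L : ℝ) ^ 4 *
        (expect ((pairField dWaveFormFactor L)ᴴ * pairField dWaveFormFactor L) ψ).re := by
    field_simp
    ring
  rw [h3, sub_div] at h2
  linarith

end Master

section Probe

/-- **The anchor from any probe schedule.** If for every `δ ∈ [1/10,2/5]` there are thresholds
`U₀, K > 0` (`K·U₀ ≤ 1/20`) and, for `U ∈ (0,U₀]`, `g ∈ [K·U,1/10]`, a margin `m > 0` such that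
eventually in even `L` some inverse temperature `β_L > 0`, chemical potential `μ_L` and probe
source `s_L` (all three may depend on `L`) satisfy
`m ≤ [p̃_L(β,μ,U,s) − p̃_L(β,μ,U,0)] − s²/g − [E_L(U,g)/L² + p_L(β,μ,U,g) − μN_L/L²]`
(`N_L = 2⌊(1−δ)L²/2⌋`), then `TwSeededRung` holds (verbatim body), with `c(U,g) = m/g`.
[folklore] -/
theorem twSeededRung_of_probe
    (H : ∀ δ ∈ Set.Icc (1/10 : ℝ) (2/5 : ℝ), ∃ U₀ K : ℝ, 0 < U₀ ∧ 0 < K ∧ K * U₀ ≤ 1 / 20 ∧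
      ∀ U ∈ Set.Ioc (0 : ℝ) U₀, ∀ g ∈ Set.Icc (K * U) (1 / 10), ∃ m : ℝ, 0 < m ∧ ∃ L₀ : ℕ,
        ∀ (L : ℕ) [NeZero L], L₀ ≤ L → Even L → ∃ β μ s : ℝ, 0 < β ∧
          m ≤ (Real.log (partitionFn β (dWaveSourceTorus L U μ s)).re / (β * (L : ℝ) ^ 2) -
                Real.log (partitionFn β (dWaveSourceTorus L U μ 0)).re / (β * (L : ℝ) ^ 2)) -
              s ^ 2 / g -
              ((hubbardTorus 2 L 1 U - ((g / (L : ℝ) ^ 2 : ℝ) : ℂ) •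
                    ((pairField dWaveFormFactor L)ᴴ * pairField dWaveFormFactor L)).minEnergyOn
                  (szSector (Λ := FermionTorus 2 L) (2 * ⌊(1 - δ) * (L : ℝ) ^ 2 / 2⌋₊) 0) /
                    (L : ℝ) ^ 2 +
                Real.log (partitionFn β (hubbardTorusWith 2 L 1 U μ -
                  ((g / (L : ℝ) ^ 2 : ℝ) : ℂ) •
                    ((pairField dWaveFormFactor L)ᴴ * pairField dWaveFormFactor L))).re /
                      (β * (L : ℝ) ^ 2) -
                μ * ((2 * ⌊(1 - δ) * (L : ℝ) ^ 2 / 2⌋₊ : ℕ) : ℝ) / (L : ℝ) ^ 2)) :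
    ∀ δ ∈ Set.Icc (1/10 : ℝ) (2/5 : ℝ), ∃ U₀ K : ℝ, 0 < U₀ ∧ 0 < K ∧ K * U₀ ≤ 1 / 20 ∧
      ∀ U ∈ Set.Ioc (0 : ℝ) U₀, (∀ g ∈ Set.Icc (K * U) (1 / 10), ∃ c : ℝ, 0 < c ∧ ∃ L₀ : ℕ,
        ∀ (L : ℕ) [NeZero L], L₀ ≤ L → Even L →
          ∀ (ψ : Fock (Orb (FermionTorus 2 L))), star ψ ⬝ᵥ ψ = 1 →
            IsGroundStateInSector (hubbardTorus 2 L 1 U - ((g / (L : ℝ) ^ 2 : ℝ) : ℂ) •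
              ((pairField dWaveFormFactor L)ᴴ * pairField dWaveFormFactor L))
                (2 * ⌊(1 - δ) * (L : ℝ) ^ 2 / 2⌋₊) 0 ψ →
            c * (L : ℝ) ^ 4 ≤
              (expect ((pairField dWaveFormFactor L)ᴴ * pairField dWaveFormFactor L) ψ).re) := by
  intro δ hδ
  obtain ⟨U₀, K, hU₀, hK, hKU₀, hU⟩ := H δ hδ
  refine ⟨U₀, K, hU₀, hK, hKU₀, fun U hUm g hg => ?_⟩
  obtain ⟨m, hm, L₀, hL₀⟩ := hU U hUm g hg
  have hgpos : 0 < g := (mul_pos hK hUm.1).trans_le hg.1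
  refine ⟨m / g, div_pos hm hgpos, L₀, fun L _ hL hEven ψ hψ hgs => ?_⟩
  obtain ⟨β, μ, s, hβ, hmle⟩ := hL₀ L hL hEven
  have hLpos : (0 : ℝ) < (L : ℝ) := by exact_mod_cast NeZero.pos L
  have hL4 : (0 : ℝ) < (L : ℝ) ^ 4 := by positivity
  have key := hmle.trans (tw_rung_master L U μ hβ hgpos s hψ hgs)
  -- `m ≤ (g/L⁴)·P` gives `(m/g)·L⁴ ≤ P`
  have h1 : m * (L : ℝ) ^ 4 ≤
      g * (expect ((pairField dWaveFormFactor L)ᴴ * pairField dWaveFormFactor L) ψ).re := by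
    have h2 := mul_le_mul_of_nonneg_right key hL4.le
    have h3 : g / (L : ℝ) ^ 4 *
        (expect ((pairField dWaveFormFactor L)ᴴ * pairField dWaveFormFactor L) ψ).re * (L : ℝ) ^ 4 =
        g * (expect ((pairField dWaveFormFactor L)ᴴ * pairField dWaveFormFactor L) ψ).re := by
      field_simp
    linarith
  rw [div_mul_eq_mul_div, div_le_iff₀ hgpos]
  linarith

end Probe

section WeakInputs

/-- **The anchor from μ-UNIFORM sourced condensation and a PER-`L` ensemble defect bound** — the
weakest pair of crux-shaped inputs the thermal-wedge rung needs, both in the thermal window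
`1 ≤ β ≤ e^{a/U}` only:
* `hCondU` = `TwSourcedCondensation` with the finite-size threshold chosen BEFORE the chemical
  potential (`∃ L₀ ∀ L ≥ L₀ ∀ μ ∈ [μ₁,μ₂]`: uniformity in `μ` over the compact window, as every
  expansion-based proof provides; NOT the refuted `L₀`-before-`β` strengthening);
* `hDefL` = the seeded canonical/grand-canonical defect bound with `β` CAPPED at `e^{a/U}` for SOME
  `a > 0` and the canonical chemical potential chosen AFTER `L` (`∀ ε ∃ L₀ ∀ L ≥ L₀ ∃ μ_L ∈ [μ₁,μ₂]`)
  — implied by `TwSeededEnsembleEquivalence` as filed and by its narrowing `CruxNarrow`.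
Conclusion = `TwSeededRung` (verbatim body). Constants: `a := min aᵉ aᶜ`, `β = e^{a/U}`,
`s = e^{-a/(4U)}`, `ε = c a s²/(32U)`, `K = 16/(ca)`, `c(U,g) = c a s²/(8Ug)`; assembled on
`tw_rung_master` + `twr_margin`. [folklore] -/
theorem twSeededRung_of_uniformGain_perLDefect
    (hCondU : ∀ μ₁ μ₂ : ℝ, -4 < μ₁ → μ₁ ≤ μ₂ → μ₂ < 0 → ∃ U₀ a c C h₀ : ℝ, 0 < U₀ ∧ 0 < a ∧
      0 < c ∧ 0 < C ∧ 0 < h₀ ∧ ∀ U : ℝ, 0 < U → U ≤ U₀ → ∀ β : ℝ, 1 ≤ β → β ≤ Real.exp (a / U) →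
        ∃ L₀ : ℕ, ∀ (L : ℕ) [NeZero L], L₀ ≤ L → ∀ μ ∈ Set.Icc μ₁ μ₂, ∀ h : ℝ, |h| ≤ h₀ →
          c * h ^ 2 * Real.log (1 / (|h| + 1 / β)) - C * h ^ 2 ≤
            (Real.log (Matrix.partitionFn β (dWaveSourceTorus L U μ h)).re / (β * (L : ℝ) ^ 2)) -
              (Real.log (Matrix.partitionFn β (dWaveSourceTorus L U μ 0)).re / (β * (L : ℝ) ^ 2)))
    (hDefL : ∀ δ ∈ Set.Icc (1/10 : ℝ) (2/5 : ℝ), ∃ μ₁ μ₂ : ℝ, -4 < μ₁ ∧ μ₁ ≤ μ₂ ∧ μ₂ < 0 ∧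
      ∃ a U₀ : ℝ, 0 < a ∧ 0 < U₀ ∧ ∀ U ∈ Set.Ioc (0 : ℝ) U₀, ∀ g ∈ Set.Ioc (0 : ℝ) (1 / 10),
        ∀ β : ℝ, 1 ≤ β → β ≤ Real.exp (a / U) → ∀ ε : ℝ, 0 < ε → ∃ L₀ : ℕ,
          ∀ (L : ℕ) [NeZero L], L₀ ≤ L → ∃ μ ∈ Set.Icc μ₁ μ₂,
            ((hubbardTorus 2 L 1 U - ((g / (L : ℝ) ^ 2 : ℝ) : ℂ) •
              ((pairField dWaveFormFactor L)ᴴ * pairField dWaveFormFactor L)).minEnergyOn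
                (szSector (Λ := FermionTorus 2 L) (2 * ⌊(1 - δ) * (L : ℝ) ^ 2 / 2⌋₊) 0) /
                  (L : ℝ) ^ 2) +
              (Real.log (Matrix.partitionFn β (hubbardTorusWith 2 L 1 U μ -
                ((g / (L : ℝ) ^ 2 : ℝ) : ℂ) •
                  ((pairField dWaveFormFactor L)ᴴ * pairField dWaveFormFactor L))).re /
                    (β * (L : ℝ) ^ 2)) -
              μ * ((2 * ⌊(1 - δ) * (L : ℝ) ^ 2 / 2⌋₊) : ℝ) / (L : ℝ) ^ 2 ≤ Real.log 4 / β + ε) :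
    ∀ δ ∈ Set.Icc (1/10 : ℝ) (2/5 : ℝ), ∃ U₀ K : ℝ, 0 < U₀ ∧ 0 < K ∧ K * U₀ ≤ 1 / 20 ∧
      ∀ U ∈ Set.Ioc (0 : ℝ) U₀, (∀ g ∈ Set.Icc (K * U) (1 / 10), ∃ c : ℝ, 0 < c ∧ ∃ L₀ : ℕ,
        ∀ (L : ℕ) [NeZero L], L₀ ≤ L → Even L →
          ∀ (ψ : Fock (Orb (FermionTorus 2 L))), star ψ ⬝ᵥ ψ = 1 →
            IsGroundStateInSector (hubbardTorus 2 L 1 U - ((g / (L : ℝ) ^ 2 : ℝ) : ℂ) •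
              ((pairField dWaveFormFactor L)ᴴ * pairField dWaveFormFactor L))
                (2 * ⌊(1 - δ) * (L : ℝ) ^ 2 / 2⌋₊) 0 ψ →
            c * (L : ℝ) ^ 4 ≤
              (expect ((pairField dWaveFormFactor L)ᴴ * pairField dWaveFormFactor L) ψ).re) := by
  intro δ hδ
  obtain ⟨μ₁, μ₂, hμ₁, hμ₁₂, hμ₂, ae, U₀e, hae, hU₀e, hE⟩ := hDefL δ hδ
  obtain ⟨U₀c, ac, c, C, h₀, hU₀c, hac, hc, hC, hh₀, hCo⟩ := hCondU μ₁ μ₂ hμ₁ hμ₁₂ hμ₂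
  -- the common thermal exponent
  set a : ℝ := min ae ac with hadef
  have ha : 0 < a := lt_min hae hac
  have hale : a ≤ ae := min_le_left _ _
  have halc : a ≤ ac := min_le_right _ _
  have hlog2 : 0 < Real.log 2 := Real.log_pos (by norm_num)
  have hlog4 : 0 < Real.log 4 := Real.log_pos (by norm_num)
  have hden : 0 < c * Real.log 2 + C + Real.log 4 := by positivity
  -- constants
  set K : ℝ := 16 / (c * a) with hKdef
  have hK : 0 < K := by positivity
  set U₁ : ℝ := a * h₀ / 4 with hU₁def
  set U₂ : ℝ := c * a / (32 * (c * Real.log 2 + C + Real.log 4)) with hU₂def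
  have hU₁ : 0 < U₁ := by positivity
  have hU₂ : 0 < U₂ := by positivity
  have h20K : 0 < 1 / (20 * K) := by positivity
  set U₀ : ℝ := min (min U₀e U₀c) (min (1 / (20 * K)) (min U₁ U₂)) with hU₀def
  have hU₀ : 0 < U₀ := lt_min (lt_min hU₀e hU₀c) (lt_min h20K (lt_min hU₁ hU₂))
  refine ⟨U₀, K, hU₀, hK, ?_, ?_⟩
  · have h1 : U₀ ≤ 1 / (20 * K) := (min_le_right _ _).trans (min_le_left _ _)
    calc K * U₀ ≤ K * (1 / (20 * K)) := mul_le_mul_of_nonneg_left h1 hK.le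
      _ = 1 / 20 := by field_simp
  intro U hU g hg
  obtain ⟨hU0, hUle⟩ := hU
  obtain ⟨hKU, hg10⟩ := hg
  have hUe : U ≤ U₀e := hUle.trans ((min_le_left _ _).trans (min_le_left _ _))
  have hUc : U ≤ U₀c := hUle.trans ((min_le_left _ _).trans (min_le_right _ _))
  have hUU₁ : U ≤ U₁ :=
    hUle.trans ((min_le_right _ _).trans ((min_le_right _ _).trans (min_le_left _ _)))
  have hUU₂ : U ≤ U₂ :=
    hUle.trans ((min_le_right _ _).trans ((min_le_right _ _).trans (min_le_right _ _)))
  have hKUpos : 0 < K * U := mul_pos hK hU0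
  have hgpos : 0 < g := hKUpos.trans_le hKU
  have hginv : 1 / g ≤ c * a / (16 * U) := by
    have h1 := one_div_le_one_div_of_le hKUpos hKU
    have e : 1 / (K * U) = c * a / (16 * U) := by
      rw [hKdef]
      field_simp
    linarith
  have hsmall : c * Real.log 2 + C + Real.log 4 ≤ c * a / (32 * U) := by
    rw [hU₂def, le_div_iff₀ (by positivity)] at hUU₂
    rw [le_div_iff₀ (by positivity)]
    linarith
  -- temperature (inside both thermal windows), probe source, allowance
  set β : ℝ := Real.exp (a / U) with hβdef
  have haU : 0 < a / U := div_pos ha hU0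
  have hβ1 : 1 ≤ β := Real.one_le_exp haU.le
  have hβpos : 0 < β := Real.exp_pos _
  have hβe : β ≤ Real.exp (ae / U) :=
    Real.exp_le_exp.2 (div_le_div_of_nonneg_right hale hU0.le)
  have hβc : β ≤ Real.exp (ac / U) :=
    Real.exp_le_exp.2 (div_le_div_of_nonneg_right halc hU0.le)
  set s : ℝ := Real.exp (-(a / (4 * U))) with hsdef
  have hspos : 0 < s := Real.exp_pos _
  have hs_le : s ≤ h₀ := by
    have hx : 0 < a / (4 * U) := by positivity
    have h1 : a / (4 * U) + 1 ≤ Real.exp (a / (4 * U)) := Real.add_one_le_exp _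
    have h2 : s = (Real.exp (a / (4 * U)))⁻¹ := by rw [hsdef, Real.exp_neg]
    have h3 : s ≤ (a / (4 * U))⁻¹ := by
      rw [h2]
      exact inv_anti₀ hx (by linarith)
    have h4 : (a / (4 * U))⁻¹ = 4 * U / a := by rw [inv_div]
    have h5 : 4 * U / a ≤ h₀ := by
      rw [div_le_iff₀ ha]
      rw [hU₁def, le_div_iff₀ (by norm_num : (0 : ℝ) < 4)] at hUU₁
      linarith
    linarith [h4 ▸ h3]
  set ε : ℝ := c * a / (32 * U) * s ^ 2 with hεdef
  have hε : 0 < ε := by positivity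
  -- thresholds: the gain is uniform in `μ`, the defect picks `μ_L` after `L`
  obtain ⟨L₂, hL₂⟩ := hCo U hU0 hUc β hβ1 hβc
  obtain ⟨L₁, hL₁⟩ := hE U ⟨hU0, hUe⟩ g ⟨hgpos, hg10⟩ β hβ1 hβe ε hε
  refine ⟨c * a * s ^ 2 / (8 * U) / g, by positivity, max L₁ L₂, ?_⟩
  intro L _ hL _hEven ψ hψ hgs
  have hL1 : L₁ ≤ L := (le_max_left _ _).trans hL
  have hL2 : L₂ ≤ L := (le_max_right _ _).trans hL
  have hLpos : (0 : ℝ) < (L : ℝ) := by exact_mod_cast NeZero.pos L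
  have hL4 : (0 : ℝ) < (L : ℝ) ^ 4 := by positivity
  obtain ⟨μ, hμ, hup⟩ := hL₁ L hL1
  have hcond := hL₂ L hL2 μ hμ s (by rw [abs_of_pos hspos]; exact hs_le)
  -- the master inequality at `(β, μ_L, s)` and the margin
  have hmaster := tw_rung_master L U μ hβpos hgpos s hψ hgs
  have hn' : μ * ((2 * ⌊(1 - δ) * (L : ℝ) ^ 2 / 2⌋₊ : ℕ) : ℝ) / (L : ℝ) ^ 2 =
      μ * ((2 * ⌊(1 - δ) * (L : ℝ) ^ 2 / 2⌋₊) : ℝ) / (L : ℝ) ^ 2 := by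
    push_cast
    ring
  rw [hn'] at hmaster
  have hm := twr_margin (g := g) ha hc hU0 hβdef hsdef hginv hsmall hεdef
  -- `c a s²/(8U) ≤ (g/L⁴)·P`, hence `(c a s²/(8U)/g)·L⁴ ≤ P`
  have key : c * a * s ^ 2 / (8 * U) ≤ g / (L : ℝ) ^ 4 *
      (expect ((pairField dWaveFormFactor L)ᴴ * pairField dWaveFormFactor L) ψ).re := by
    linarith
  have h1 : c * a * s ^ 2 / (8 * U) * (L : ℝ) ^ 4 ≤
      g * (expect ((pairField dWaveFormFactor L)ᴴ * pairField dWaveFormFactor L) ψ).re := by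
    have h2 := mul_le_mul_of_nonneg_right key hL4.le
    have h3 : g / (L : ℝ) ^ 4 *
        (expect ((pairField dWaveFormFactor L)ᴴ * pairField dWaveFormFactor L) ψ).re * (L : ℝ) ^ 4 =
        g * (expect ((pairField dWaveFormFactor L)ᴴ * pairField dWaveFormFactor L) ψ).re := by
      field_simp
    linarith
  rw [div_mul_eq_mul_div, div_le_iff₀ hgpos]
  linarith

end WeakInputs

end Summit.HubbardSuperconductivity.HubbardSuperconductivity.Theorems
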